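import Summits.Parity.GeneralizedHardyLittlewood.Theorems.GreenTaoLevelTwoGITwoQuadraticPhaseRungLemmas
import HarnessLib

/-!
# Route `GreenTaoLevelTwo`, crux `GITwo` (stmt-Parity-21275), line `birth`: the BC5 rung
# `stub_rung_quadraticPhase` — quadratic phases are Heisenberg nilsequences, uniformly

The registered BC5 rung of the `GITwo` birth skeleton: for EVERY Def-8.1 metric `d` on
`H³(ℝ)/H³(ℤ)` that is box-comparable (`IsBoxComparable d`, constant `L`), there are `M, c`
(here `M = 8πL`, `c = ½`) such that every quadratic phase `e(αn² + βn)` on `[N]` correlates `≥ c`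
with a `1`-bounded `M`-Lipschitz nilsequence `F(gⁿ x₀)` on the re-metrised Heisenberg nilmanifold
`heisenbergWith d h` — uniformly in `N ≥ 1`, `α`, `β`.  This is the "construct" half of Green–Tao's
conversion of quadratic phases into Heisenberg nilsequences (the proof of Thm. 12.8 / Prop. 12.9 of
the `U³` inverse paper), carried out with explicit constants.

Construction (all explicit, no new definitions; §1–§4 are the helper file
`GreenTaoLevelTwoGITwoQuadraticPhaseRungLemmas.lean`, §5 is this file):
* the test function on `H³(ℝ)` is `Φ(x, y, z) = cos(2π(z − x⌊y⌋)) · sin²(πy)`; it is invariant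
  under RIGHT multiplication by `Γ = H³(ℤ)` (`z − x⌊y⌋` moves by an integer, `sin²(πy)` is
  `1`-periodic), so `F(p) = Φ(out p)` is a function on `G/Γ` with `F(gΓ) = Φ(g)`;
* `|Φ| ≤ 1` and `|Φ(g) − Φ(h)| ≤ 8π · S(g h⁻¹)` for the box gauge `S` (§1: if `⌊y_g⌋ = ⌊y_h⌋` the
  phase moves by `≤ 2S` and `sin²` by `≤ 2πS`; otherwise both `sin²` factors are `≤ πS`), whence
  `|F(p) − F(q)| ≤ 8π ρ₀(p, q) ≤ 8πL · d(p, q)`;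
* with `g = (−2α, 1, β)` and `x₀ = (0, ½, z₀)Γ` the orbit has `y = n + ½` and
  `z − x⌊y⌋ = αn² + βn + z₀`, so `F(gⁿ x₀) = cos(2π(αn² + βn + z₀))`;
* `∑ e(θₙ) cos(2π(θₙ + z₀)) = (e(z₀) T + N e(−z₀))/2` with `T = ∑ e(2θₙ)`; since
  `‖T + N‖ + ‖N − T‖ ≥ 2N`, one of `z₀ = 0` (`‖T + N‖/2`) or `z₀ = ¼` (`‖N − T‖/2`) gives `≥ N/2`.

References: B. Green, T. Tao, *An inverse theorem for the Gowers U³(G) norm*, Proc. Edinb. Math.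
Soc. 51 (2008) 73–153, §12 (quadratic phases as Heisenberg nilsequences; the cube coordinates and
the `2π`-Lipschitz test functions) [GreenTao2008U3Inverse]; B. Green, T. Tao, *Linear equations in
primes*, Ann. of Math. 171 (2010), §8 (the Heisenberg example) [GreenTao2010].
-/

noncomputable section

open Literature.NumberTheory.Sieve
open Literature.NumberTheory.Sieve.GreenTaoLevelTwo

namespace Summit.Parity.GeneralizedHardyLittlewood.GreenTaoLevelTwoGITwoQuadraticPhaseRung

/-! ### §5 The rung -/

/-- **BC5 rung of the `GITwo` skeleton (`stub_rung_quadraticPhase`)**: quadratic phases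
`e(αn² + βn)` on `[N]` are Heisenberg nilsequences over EVERY box-comparable realisation
`(H_d, d)`, quantitatively and uniformly in `N ≥ 1`, `α`, `β`: with `M = 8πL` (`L` the
comparability constant of `d`) and `c = ½` there are `g = (−2α, 1, β)`, `x₀ = (0, ½, z₀)Γ`
(`z₀ ∈ {0, ¼}`) and the `1`-bounded `M`-Lipschitz `F(gΓ) = cos(2π(z − x⌊y⌋)) sin²(πy)` with
`‖𝔼_{n ∈ [N]} e(αn² + βn) F(gⁿ x₀)‖ ≥ ½`. [cite: GreenTao2008U3Inverse, §12 (proof of Thm. 12.8: quadratic phases as Heisenberg nilsequences)] -/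
theorem stub_rung_quadraticPhase :
    ∀ (d : HX → HX → ℝ) (h : IsCompatMetric d), IsBoxComparable d →
    ∃ M c : ℝ, 0 < c ∧ ∀ (N : ℕ), 1 ≤ N → ∀ α β : ℝ,
      ∃ (g : (heisenbergWith d h).G) (x₀ : (heisenbergWith d h).G ⧸ (heisenbergWith d h).Γ)
        (F : (heisenbergWith d h).G ⧸ (heisenbergWith d h).Γ → ℝ),
        (heisenbergWith d h).IsBoundedLipschitz M F ∧
          c ≤ ‖(∑ n ∈ Finset.Icc (1 : ℤ) N,
              Complex.exp (2 * Real.pi * Complex.I * ((α * (n : ℝ) ^ 2 + β * n : ℝ) : ℂ)) *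
                (F (g ^ n • x₀) : ℂ)) / (N : ℂ)‖ := by
  intro d h hbox
  obtain ⟨L, hL, hcomp⟩ := hbox
  refine ⟨8 * Real.pi * L, 1 / 2, by norm_num, ?_⟩
  intro N hN α β
  have hNpos : (0 : ℝ) < N := by exact_mod_cast hN
  -- the function `F(gΓ) = Φ(g)` on `H_d` (the same for every `N, α, β`), bounded and Lipschitz
  have hF : (heisenbergWith d h).IsBoundedLipschitz (8 * Real.pi * L)
      (fun p : HX => Real.cos (2 * Real.pi * ((Quotient.out p : Heis).z -
        (Quotient.out p : Heis).x * ⌊(Quotient.out p : Heis).y⌋)) *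
        Real.sin (Real.pi * (Quotient.out p : Heis).y) ^ 2) := by
    refine ⟨fun p => abs_phi_le_one _, fun p q => ?_⟩
    calc _ ≤ 8 * Real.pi * heisPreDist p q := abs_F_sub_F_le_heisPreDist p q
      _ ≤ 8 * Real.pi * (L * d p q) :=
          mul_le_mul_of_nonneg_left (hcomp p q).1 (by positivity)
      _ = 8 * Real.pi * L * (heisenbergWith d h).dist p q := by
          show _ = 8 * Real.pi * L * d p q
          ring
  -- the exponential sum `T = ∑ e(2θₙ)`
  set T : ℂ := ∑ n ∈ Finset.Icc (1 : ℤ) N,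
    Complex.exp (2 * Real.pi * Complex.I * ((2 * (α * (n : ℝ) ^ 2 + β * n) : ℝ) : ℂ)) with hT
  -- the orbit sums for the base point `(0, ½, z₀)Γ`
  have hsum : ∀ z₀ : ℝ,
      ∑ n ∈ Finset.Icc (1 : ℤ) N,
        Complex.exp (2 * Real.pi * Complex.I * ((α * (n : ℝ) ^ 2 + β * n : ℝ) : ℂ)) *
          ((Real.cos (2 * Real.pi *
            ((Quotient.out ((Heis.mk (-2 * α) 1 β) ^ n • ((Heis.mk 0 (1 / 2) z₀ : Heis) : HX)) :
                Heis).z -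
              (Quotient.out ((Heis.mk (-2 * α) 1 β) ^ n • ((Heis.mk 0 (1 / 2) z₀ : Heis) : HX)) :
                Heis).x *
              ⌊(Quotient.out ((Heis.mk (-2 * α) 1 β) ^ n •
                ((Heis.mk 0 (1 / 2) z₀ : Heis) : HX)) : Heis).y⌋)) *
            Real.sin (Real.pi * (Quotient.out ((Heis.mk (-2 * α) 1 β) ^ n •
              ((Heis.mk 0 (1 / 2) z₀ : Heis) : HX)) : Heis).y) ^ 2 : ℝ) : ℂ) =
      (Complex.exp (2 * Real.pi * Complex.I * (z₀ : ℂ)) * T +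
        (N : ℂ) * Complex.exp (-(2 * Real.pi * Complex.I * (z₀ : ℂ)))) / 2 := by
    intro z₀
    have h1 : ∑ n ∈ Finset.Icc (1 : ℤ) N,
        Complex.exp (2 * Real.pi * Complex.I * ((α * (n : ℝ) ^ 2 + β * n : ℝ) : ℂ)) *
          ((Real.cos (2 * Real.pi *
            ((Quotient.out ((Heis.mk (-2 * α) 1 β) ^ n • ((Heis.mk 0 (1 / 2) z₀ : Heis) : HX)) :
                Heis).z -
              (Quotient.out ((Heis.mk (-2 * α) 1 β) ^ n • ((Heis.mk 0 (1 / 2) z₀ : Heis) : HX)) :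
                Heis).x *
              ⌊(Quotient.out ((Heis.mk (-2 * α) 1 β) ^ n •
                ((Heis.mk 0 (1 / 2) z₀ : Heis) : HX)) : Heis).y⌋)) *
            Real.sin (Real.pi * (Quotient.out ((Heis.mk (-2 * α) 1 β) ^ n •
              ((Heis.mk 0 (1 / 2) z₀ : Heis) : HX)) : Heis).y) ^ 2 : ℝ) : ℂ) =
        ∑ n ∈ Finset.Icc (1 : ℤ) N,
          Complex.exp (2 * Real.pi * Complex.I * ((α * (n : ℝ) ^ 2 + β * n : ℝ) : ℂ)) *
            ((Real.cos (2 * Real.pi * (α * (n : ℝ) ^ 2 + β * n + z₀)) : ℝ) : ℂ) := by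
      refine Finset.sum_congr rfl fun n hn => ?_
      have hn0 : 0 ≤ n := by linarith [(Finset.mem_Icc.mp hn).1]
      rw [F_orbit α β z₀ n hn0]
    rw [h1, sum_exp_mul_cos (Finset.Icc (1 : ℤ) N) (fun n : ℤ => α * (n : ℝ) ^ 2 + β * n) z₀,
      Int.card_Icc]
    have hc : ((N : ℤ) + 1 - 1).toNat = N := by simp
    rw [hc]
  -- `‖(e(z₀) T + N e(−z₀))‖ ≥ N` gives correlation `≥ ½`
  have hkey : ∀ z₀ : ℝ, (N : ℝ) ≤ ‖Complex.exp (2 * Real.pi * Complex.I * (z₀ : ℂ)) * T +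
        (N : ℂ) * Complex.exp (-(2 * Real.pi * Complex.I * (z₀ : ℂ)))‖ →
      (1 / 2 : ℝ) ≤ ‖(∑ n ∈ Finset.Icc (1 : ℤ) N,
        Complex.exp (2 * Real.pi * Complex.I * ((α * (n : ℝ) ^ 2 + β * n : ℝ) : ℂ)) *
          ((Real.cos (2 * Real.pi *
            ((Quotient.out ((Heis.mk (-2 * α) 1 β) ^ n • ((Heis.mk 0 (1 / 2) z₀ : Heis) : HX)) :
                Heis).z -
              (Quotient.out ((Heis.mk (-2 * α) 1 β) ^ n • ((Heis.mk 0 (1 / 2) z₀ : Heis) : HX)) :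
                Heis).x *
              ⌊(Quotient.out ((Heis.mk (-2 * α) 1 β) ^ n •
                ((Heis.mk 0 (1 / 2) z₀ : Heis) : HX)) : Heis).y⌋)) *
            Real.sin (Real.pi * (Quotient.out ((Heis.mk (-2 * α) 1 β) ^ n •
              ((Heis.mk 0 (1 / 2) z₀ : Heis) : HX)) : Heis).y) ^ 2 : ℝ) : ℂ)) / (N : ℂ)‖ := by
    intro z₀ hz
    rw [hsum z₀, norm_div, norm_div, Complex.norm_natCast, Complex.norm_two,
      le_div_iff₀ hNpos, le_div_iff₀ (two_pos : (0 : ℝ) < 2)]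
    linarith
  rcases norm_dichotomy T N with hA | hB
  · -- `z₀ = 0`: the sum is `(T + N)/2`
    refine ⟨Heis.mk (-2 * α) 1 β, ((Heis.mk 0 (1 / 2) 0 : Heis) : HX), _, hF, ?_⟩
    refine hkey 0 ?_
    simpa using hA
  · -- `z₀ = ¼`: the sum is `−e(¼)(N − T)/2`
    refine ⟨Heis.mk (-2 * α) 1 β, ((Heis.mk 0 (1 / 2) (1 / 4) : Heis) : HX), _, hF, ?_⟩
    refine hkey (1 / 4) ?_
    set w : ℂ := Complex.exp (2 * Real.pi * Complex.I * ((1 / 4 : ℝ) : ℂ)) with hw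
    have hw2 : w * w = -1 := by
      rw [hw, ← Complex.exp_add, ← Complex.exp_pi_mul_I]
      congr 1
      push_cast
      ring
    have hwn : ‖w‖ = 1 := by
      have e : 2 * (Real.pi : ℂ) * Complex.I * ((1 / 4 : ℝ) : ℂ) =
          ((Real.pi / 2 : ℝ) : ℂ) * Complex.I := by
        push_cast
        ring
      rw [hw, e, Complex.norm_exp_ofReal_mul_I]
    have hwinv : w⁻¹ = -w := inv_eq_of_mul_eq_one_right (by rw [mul_neg, hw2, neg_neg])
    rw [Complex.exp_neg, ← hw, hwinv]
    have e : w * T + (N : ℂ) * -w = -w * ((N : ℂ) - T) := by ring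
    rw [e, norm_mul, norm_neg, hwn, one_mul]
    exact hB

end Summit.Parity.GeneralizedHardyLittlewood.GreenTaoLevelTwoGITwoQuadraticPhaseRung

end
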